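import Mathlib
import Summits.CriticalPhenomena.CardyFormulaZ2.Theorems.CardySelfRefinementDefs
import Literature.Probability.Percolation.QuadCrossingSpaceProofs
import HarnessLib

/-!
# Boundary-layer surgery, topology brick (S4), part I: the inset path in the unit square

Helper file of the registered stub `stub_layerLocalModification` (the deterministic
boundary-layer surgery) of the line `monotone-product-coordinates` (crux
`stmt-CriticalPhenomena-10269`, `…Theses.CardySelfRefinement.GradientComparability`).  Step (S4)
of the layer surgery (the cell-contact lemma, file `…StubLayerContact.lean`) cuts the open quad
`[Q]°` along the cross-cut `β_ε` through the point `m_ε = p + ε (p' - p)` of a no-room lattice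
edge `e = [p, p']`: on either side of `e`, `β_ε` follows the three other sides of the mesh cell
beside `e`, inset by `ε` into the open cell, until it first leaves `[Q]°`.  This file supplies
the model of that path in the unit square, as a two-parameter family `S ε t`
(`exists_squareInsetPath`, registered helper): for the inset `ε` and the time `t ∈ [0, 1]`,
`S ε` runs at constant speed on each third of `[0, 1]` along the polygon
`(ε, 0) → (ε, 1 - ε) → (1 - ε, 1 - ε) → (1 - ε, 0)`; we record its continuity, injectivity
(`ε < 1/2`), the straight initial piece, the distance of the two other pieces from the initial
point, the position of its points in the square, the uniform distance `≤ 2ε` to the limit walk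
`S 0` (the three sides `0 → i → 1 + i → 1` of the square), and the sub-segments of that walk.
Elementary real arithmetic; no percolation, no named fact.
-/

noncomputable section

namespace Summit.CriticalPhenomena.CardyFormulaZ2.Theorems.CardySelfRefinement

open scoped Topology
open Filter Set MeasureTheory
open Literature.Probability.LatticeModels Literature.Probability.Percolation
open Literature.Probability.Percolation.QuadCrossing
open Summit.CriticalPhenomena.CardyFormulaZ2.Theses.CardySelfRefinement

section SquareInset

variable {S : ℝ → ℝ → ℂ}
  (hS : ∀ ε t, S ε t = if t ≤ 1 / 3 then (ε : ℂ) + ((3 * t * (1 - ε) : ℝ) : ℂ) * Complex.I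
    else if t ≤ 2 / 3 then ((ε + (3 * t - 1) * (1 - 2 * ε) : ℝ) : ℂ) + ((1 - ε : ℝ) : ℂ) * Complex.I
    else ((1 - ε : ℝ) : ℂ) + (((3 - 3 * t) * (1 - ε) : ℝ) : ℂ) * Complex.I)

include hS

/-- The inset path on the first third: the left side `(ε, 0) → (ε, 1 - ε)`. -/
theorem squareInset_piece₁ (ε : ℝ) {t : ℝ} (ht : t ≤ 1 / 3) :
    S ε t = (ε : ℂ) + ((3 * t * (1 - ε) : ℝ) : ℂ) * Complex.I := by
  rw [hS, if_pos ht]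

/-- The inset path on the middle third: the top side `(ε, 1 - ε) → (1 - ε, 1 - ε)`. -/
theorem squareInset_piece₂ (ε : ℝ) {t : ℝ} (h₁ : 1 / 3 ≤ t) (h₂ : t ≤ 2 / 3) :
    S ε t = ((ε + (3 * t - 1) * (1 - 2 * ε) : ℝ) : ℂ) + ((1 - ε : ℝ) : ℂ) * Complex.I := by
  rcases h₁.eq_or_lt with rfl | h₁
  · rw [hS, if_pos le_rfl]; push_cast; ring
  · rw [hS, if_neg (not_le.2 h₁), if_pos h₂]

/-- The inset path on the last third: the right side `(1 - ε, 1 - ε) → (1 - ε, 0)`. -/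
theorem squareInset_piece₃ (ε : ℝ) {t : ℝ} (h : 2 / 3 ≤ t) :
    S ε t = ((1 - ε : ℝ) : ℂ) + (((3 - 3 * t) * (1 - ε) : ℝ) : ℂ) * Complex.I := by
  rcases h.eq_or_lt with rfl | h
  · rw [hS, if_neg (by norm_num), if_pos le_rfl]; push_cast; ring
  · rw [hS, if_neg (by linarith), if_neg (not_le.2 h)]

/-- The inset path is continuous in time. -/
theorem continuous_squareInset (ε : ℝ) : Continuous (S ε) := by
  have h : S ε = fun t => if t ≤ 1 / 3 then (ε : ℂ) + ((3 * t * (1 - ε) : ℝ) : ℂ) * Complex.I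
      else if t ≤ 2 / 3 then ((ε + (3 * t - 1) * (1 - 2 * ε) : ℝ) : ℂ) + ((1 - ε : ℝ) : ℂ) *
        Complex.I else ((1 - ε : ℝ) : ℂ) + (((3 - 3 * t) * (1 - ε) : ℝ) : ℂ) * Complex.I :=
    funext (hS ε)
  rw [h]
  refine Continuous.if_le (by fun_prop) ?_ continuous_id continuous_const ?_
  · refine Continuous.if_le (by fun_prop) (by fun_prop) continuous_id continuous_const ?_
    rintro t rfl
    push_cast; ring
  · rintro t rfl
    rw [if_pos (by norm_num)]
    push_cast; ring

/-- Coordinates of the points of the inset path: for `0 ≤ ε ≤ 1/2` and `t ∈ [0, 1]` the point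
`S ε t` has abscissa in `[ε, 1 - ε]` and ordinate in `[0, 1 - ε]`, positive for `0 < t < 1`. -/
theorem squareInset_coord {ε : ℝ} (hε : ε ∈ Icc (0 : ℝ) (1 / 2)) {t : ℝ} (ht : t ∈ Icc (0 : ℝ) 1) :
    (S ε t).re ∈ Icc ε (1 - ε) ∧ (S ε t).im ∈ Icc 0 (1 - ε) ∧
      (t ∈ Ioo (0 : ℝ) 1 → 0 < (S ε t).im) := by
  obtain ⟨hε0, hε1⟩ := hε
  obtain ⟨ht0, ht1⟩ := ht
  rcases le_or_gt t (1 / 3) with h1 | h1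
  · rw [squareInset_piece₁ hS ε h1, (Quad.re_im_ofReal_add_ofReal_mul_I _ _).1,
      (Quad.re_im_ofReal_add_ofReal_mul_I _ _).2]
    refine ⟨⟨le_rfl, by linarith⟩, ⟨by nlinarith, by nlinarith⟩, fun h => ?_⟩
    have := h.1
    nlinarith
  rcases le_or_gt t (2 / 3) with h2 | h2
  · rw [squareInset_piece₂ hS ε h1.le h2, (Quad.re_im_ofReal_add_ofReal_mul_I _ _).1,
      (Quad.re_im_ofReal_add_ofReal_mul_I _ _).2]
    refine ⟨⟨by nlinarith, by nlinarith⟩, ⟨by linarith, le_rfl⟩, fun _ => by linarith⟩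
  · rw [squareInset_piece₃ hS ε h2.le, (Quad.re_im_ofReal_add_ofReal_mul_I _ _).1,
      (Quad.re_im_ofReal_add_ofReal_mul_I _ _).2]
    refine ⟨⟨by linarith, le_rfl⟩, ⟨by nlinarith, by nlinarith⟩, fun h => ?_⟩
    have := h.2
    nlinarith

/-- The inset path is injective in time (`0 ≤ ε < 1/2`). -/
theorem injOn_squareInset {ε : ℝ} (hε : ε ∈ Ico (0 : ℝ) (1 / 2)) : InjOn (S ε) (Icc 0 1) := by
  obtain ⟨hε0, hε1⟩ := hε
  have hε2 : (1 : ℝ) - ε ≠ 0 := by linarith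
  have hε3 : (1 : ℝ) - 2 * ε ≠ 0 := by linarith
  -- it suffices to treat `s ≤ t`
  suffices key : ∀ s ∈ Icc (0 : ℝ) 1, ∀ t ∈ Icc (0 : ℝ) 1, s ≤ t → S ε s = S ε t → s = t by
    intro s hs t ht hst
    rcases le_total s t with h | h
    · exact key s hs t ht h hst
    · exact (key t ht s hs h hst.symm).symm
  intro s hs t ht hst heq
  have hre := congrArg Complex.re heq
  have him := congrArg Complex.im heq
  rcases le_or_gt t (1 / 3) with ht1 | ht1
  · -- both on the left side
    rw [squareInset_piece₁ hS ε (hst.trans ht1), squareInset_piece₁ hS ε ht1,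
      (Quad.re_im_ofReal_add_ofReal_mul_I _ _).2, (Quad.re_im_ofReal_add_ofReal_mul_I _ _).2] at him
    have := mul_right_cancel₀ hε2 him
    linarith
  rcases le_or_gt t (2 / 3) with ht2 | ht2
  · rw [squareInset_piece₂ hS ε ht1.le ht2] at hre him
    rcases le_or_gt s (1 / 3) with hs1 | hs1
    · -- left side against top side: only the common corner
      rw [squareInset_piece₁ hS ε hs1, (Quad.re_im_ofReal_add_ofReal_mul_I _ _).1,
        (Quad.re_im_ofReal_add_ofReal_mul_I _ _).1] at hre
      have h3 : (3 * t - 1) * (1 - 2 * ε) = 0 := by linarith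
      rcases mul_eq_zero.1 h3 with h | h
      · linarith
      · exact absurd h hε3
    · rw [squareInset_piece₂ hS ε hs1.le (hst.trans ht2), (Quad.re_im_ofReal_add_ofReal_mul_I _ _).1,
        (Quad.re_im_ofReal_add_ofReal_mul_I _ _).1] at hre
      have h3 : (3 * s - 1) * (1 - 2 * ε) = (3 * t - 1) * (1 - 2 * ε) := by linarith
      have := mul_right_cancel₀ hε3 h3
      linarith
  · rw [squareInset_piece₃ hS ε ht2.le] at hre him
    rcases le_or_gt s (1 / 3) with hs1 | hs1
    · -- left side against right side: the abscissae differ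
      rw [squareInset_piece₁ hS ε hs1, (Quad.re_im_ofReal_add_ofReal_mul_I _ _).1,
        (Quad.re_im_ofReal_add_ofReal_mul_I _ _).1] at hre
      linarith
    rcases le_or_gt s (2 / 3) with hs2 | hs2
    · -- top side against right side: only the common corner
      have hre' := hre
      rw [squareInset_piece₂ hS ε hs1.le hs2, (Quad.re_im_ofReal_add_ofReal_mul_I _ _).1,
        (Quad.re_im_ofReal_add_ofReal_mul_I _ _).1] at hre'
      rw [squareInset_piece₂ hS ε hs1.le hs2, (Quad.re_im_ofReal_add_ofReal_mul_I _ _).2,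
        (Quad.re_im_ofReal_add_ofReal_mul_I _ _).2] at him
      have h3 : (3 * s - 1) * (1 - 2 * ε) = 1 * (1 - 2 * ε) := by linarith
      have h4 := mul_right_cancel₀ hε3 h3
      have h5 : 1 * (1 - ε) = (3 - 3 * t) * (1 - ε) := by linarith
      have h6 := mul_right_cancel₀ hε2 h5
      linarith
    · rw [squareInset_piece₃ hS ε hs2.le, (Quad.re_im_ofReal_add_ofReal_mul_I _ _).2,
        (Quad.re_im_ofReal_add_ofReal_mul_I _ _).2] at him
      have := mul_right_cancel₀ hε2 him
      linarith

/-- The two far pieces of the inset path stay at distance `≥ 1/2` from its initial point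
(`0 ≤ ε ≤ 1/4`, `t ≥ 1/3`). -/
theorem half_le_dist_squareInset {ε : ℝ} (hε : ε ∈ Icc (0 : ℝ) (1 / 4)) {t : ℝ}
    (ht : t ∈ Icc (1 / 3 : ℝ) 1) : 1 / 2 ≤ dist (S ε t) (S ε 0) := by
  obtain ⟨hε0, hε1⟩ := hε
  rw [Complex.dist_eq]
  have h0 : S ε 0 = (ε : ℂ) + ((0 : ℝ) : ℂ) * Complex.I := by
    rw [squareInset_piece₁ hS ε (by norm_num)]; push_cast; ring
  rcases le_or_gt t (2 / 3) with h2 | h2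
  · refine le_trans ?_ (Complex.abs_im_le_norm _)
    rw [Complex.sub_im, squareInset_piece₂ hS ε ht.1 h2, h0, (Quad.re_im_ofReal_add_ofReal_mul_I _ _).2,
      (Quad.re_im_ofReal_add_ofReal_mul_I _ _).2, abs_of_nonneg (by linarith)]
    linarith
  · refine le_trans ?_ (Complex.abs_re_le_norm _)
    rw [Complex.sub_re, squareInset_piece₃ hS ε h2.le, h0, (Quad.re_im_ofReal_add_ofReal_mul_I _ _).1,
      (Quad.re_im_ofReal_add_ofReal_mul_I _ _).1, abs_of_nonneg (by linarith)]
    linarith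

/-- The inset path is uniformly `2ε`-close to the limit walk `S 0`. -/
theorem dist_squareInset_le {ε : ℝ} (hε : ε ∈ Icc (0 : ℝ) (1 / 2)) {t : ℝ}
    (ht : t ∈ Icc (0 : ℝ) 1) : dist (S ε t) (S 0 t) ≤ 2 * ε := by
  obtain ⟨hε0, hε1⟩ := hε
  obtain ⟨ht0, ht1⟩ := ht
  rw [Complex.dist_eq]
  refine (Complex.norm_le_abs_re_add_abs_im _).trans ?_
  rw [Complex.sub_re, Complex.sub_im]
  rcases le_or_gt t (1 / 3) with h1 | h1
  · rw [squareInset_piece₁ hS ε h1, squareInset_piece₁ hS 0 h1, (Quad.re_im_ofReal_add_ofReal_mul_I _ _).1,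
      (Quad.re_im_ofReal_add_ofReal_mul_I _ _).1, (Quad.re_im_ofReal_add_ofReal_mul_I _ _).2,
      (Quad.re_im_ofReal_add_ofReal_mul_I _ _).2]
    have hre : |ε - (0 : ℝ)| ≤ ε := by rw [sub_zero, abs_of_nonneg hε0]
    have him : |3 * t * (1 - ε) - 3 * t * (1 - 0)| ≤ ε := by
      rw [abs_le]; constructor <;> nlinarith
    linarith
  rcases le_or_gt t (2 / 3) with h2 | h2
  · rw [squareInset_piece₂ hS ε h1.le h2, squareInset_piece₂ hS 0 h1.le h2,
      (Quad.re_im_ofReal_add_ofReal_mul_I _ _).1, (Quad.re_im_ofReal_add_ofReal_mul_I _ _).1,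
      (Quad.re_im_ofReal_add_ofReal_mul_I _ _).2, (Quad.re_im_ofReal_add_ofReal_mul_I _ _).2]
    have hre : |ε + (3 * t - 1) * (1 - 2 * ε) - (0 + (3 * t - 1) * (1 - 2 * 0))| ≤ ε := by
      rw [abs_le]; constructor <;> nlinarith
    have him : |1 - ε - (1 - 0)| ≤ ε := by
      rw [abs_le]; constructor <;> linarith
    linarith
  · rw [squareInset_piece₃ hS ε h2.le, squareInset_piece₃ hS 0 h2.le,
      (Quad.re_im_ofReal_add_ofReal_mul_I _ _).1, (Quad.re_im_ofReal_add_ofReal_mul_I _ _).1,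
      (Quad.re_im_ofReal_add_ofReal_mul_I _ _).2, (Quad.re_im_ofReal_add_ofReal_mul_I _ _).2]
    have hre : |1 - ε - (1 - 0)| ≤ ε := by
      rw [abs_le]; constructor <;> linarith
    have him : |(3 - 3 * t) * (1 - ε) - (3 - 3 * t) * (1 - 0)| ≤ ε := by
      rw [abs_le]; constructor <;> nlinarith
    linarith

/-- Sub-segments of the limit walk `S 0` (`0 → i → 1 + i → 1`): on each third, the segment from
the corner to `S 0 t` is covered by `S 0 [corner time, t]`, and `S 0 t` lies on that side. -/
theorem squareInset_zero_segments :
    (∀ t ∈ Icc (0 : ℝ) (1 / 3), segment ℝ 0 (S 0 t) ⊆ S 0 '' Icc 0 t ∧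
      S 0 t ∈ segment ℝ (0 : ℂ) Complex.I) ∧ S 0 (1 / 3) = Complex.I ∧
    (∀ t ∈ Icc (1 / 3 : ℝ) (2 / 3), segment ℝ Complex.I (S 0 t) ⊆ S 0 '' Icc (1 / 3) t ∧
      S 0 t ∈ segment ℝ Complex.I (1 + Complex.I)) ∧ S 0 (2 / 3) = 1 + Complex.I ∧
    (∀ t ∈ Icc (2 / 3 : ℝ) 1, segment ℝ (1 + Complex.I) (S 0 t) ⊆ S 0 '' Icc (2 / 3) t ∧
      S 0 t ∈ segment ℝ (1 + Complex.I) 1) ∧ S 0 1 = 1 := by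
  have P1 : ∀ t, t ≤ 1 / 3 → S 0 t = ((3 * t : ℝ) : ℂ) * Complex.I := fun t ht => by
    rw [squareInset_piece₁ hS 0 ht]; push_cast; ring
  have P2 : ∀ t, 1 / 3 ≤ t → t ≤ 2 / 3 → S 0 t = ((3 * t - 1 : ℝ) : ℂ) + Complex.I :=
    fun t h1 h2 => by rw [squareInset_piece₂ hS 0 h1 h2]; push_cast; ring
  have P3 : ∀ t, 2 / 3 ≤ t → S 0 t = 1 + ((3 - 3 * t : ℝ) : ℂ) * Complex.I := fun t h => by
    rw [squareInset_piece₃ hS 0 h]; push_cast; ring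
  refine ⟨fun t ht => ⟨?_, ?_⟩, ?_, fun t ht => ⟨?_, ?_⟩, ?_, fun t ht => ⟨?_, ?_⟩, ?_⟩
  · obtain ⟨ht0, ht1⟩ := ht
    rw [segment_eq_image']
    rintro _ ⟨θ, ⟨hθ0, hθ1⟩, rfl⟩
    dsimp only
    refine ⟨θ * t, ⟨by nlinarith, by nlinarith⟩, ?_⟩
    rw [P1 t ht1, P1 (θ * t) (by nlinarith), Complex.real_smul]
    push_cast; ring
  · rw [P1 t ht.2, segment_eq_image']
    refine ⟨3 * t, ⟨by linarith [ht.1], by linarith [ht.2]⟩, ?_⟩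
    simp only [Complex.real_smul]; push_cast; ring
  · rw [P1 _ le_rfl]; push_cast; ring
  · obtain ⟨ht0, ht1⟩ := ht
    rw [segment_eq_image']
    rintro _ ⟨θ, ⟨hθ0, hθ1⟩, rfl⟩
    dsimp only
    refine ⟨1 / 3 + θ * (t - 1 / 3), ⟨by nlinarith, by nlinarith⟩, ?_⟩
    rw [P2 t ht0 ht1, P2 _ (by nlinarith) (by nlinarith), Complex.real_smul]
    push_cast; ring
  · rw [P2 t ht.1 ht.2, segment_eq_image']
    refine ⟨3 * t - 1, ⟨by linarith [ht.1], by linarith [ht.2]⟩, ?_⟩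
    simp only [Complex.real_smul]; push_cast; ring
  · rw [P2 _ (by norm_num) le_rfl]; push_cast; ring
  · obtain ⟨ht0, ht1⟩ := ht
    rw [segment_eq_image']
    rintro _ ⟨θ, ⟨hθ0, hθ1⟩, rfl⟩
    dsimp only
    refine ⟨2 / 3 + θ * (t - 2 / 3), ⟨by nlinarith, by nlinarith⟩, ?_⟩
    rw [P3 t ht0, P3 _ (by nlinarith), Complex.real_smul]
    push_cast; ring
  · rw [P3 t ht.1, segment_eq_image']
    refine ⟨3 * t - 2, ⟨by linarith [ht.1], by linarith [ht.2]⟩, ?_⟩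
    simp only [Complex.real_smul]; push_cast; ring
  · rw [P3 _ (by norm_num)]; push_cast; ring

end SquareInset

/-- **The inset path in the unit square** (brick (S4), part I, of the boundary-layer surgery
`stub_layerLocalModification`; registered helper).  There is a family `S ε t` of paths in the
closed unit square — `S ε` runs `(ε, 0) → (ε, 1 - ε) → (1 - ε, 1 - ε) → (1 - ε, 0)` on the three
thirds of `[0, 1]` — which is continuous and (for `ε < 1/2`) injective in `t`, straight
(`S ε t = ε + 3t(1 - ε) i`) on the first third and at distance `≥ 1/2` from `S ε 0` afterwards
(`ε ≤ 1/4`), ends at `1 - ε`, has coordinates in `[ε, 1 - ε] × [0, 1 - ε]` with positive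
ordinate for `0 < t < 1`, is uniformly `2ε`-close to the limit walk `S 0`, and whose limit walk
`S 0` runs along the sides `0 → i → 1 + i → 1` of the square with the listed sub-segments. -/
theorem exists_squareInsetPath : ∃ S : ℝ → ℝ → ℂ, (∀ ε, Continuous (S ε)) ∧ (∀ ε ∈ Set.Ico (0 : ℝ) (1 / 2), Set.InjOn (S ε) (Set.Icc 0 1)) ∧ (∀ ε t : ℝ, t ≤ 1 / 3 → S ε t = (ε : ℂ) + ((3 * t * (1 - ε) : ℝ) : ℂ) * Complex.I) ∧ (∀ ε ∈ Set.Icc (0 : ℝ) (1 / 4), ∀ t ∈ Set.Icc (1 / 3 : ℝ) 1, 1 / 2 ≤ dist (S ε t) (S ε 0)) ∧ (∀ ε : ℝ, S ε 1 = ((1 - ε : ℝ) : ℂ)) ∧ (∀ ε ∈ Set.Icc (0 : ℝ) (1 / 2), ∀ t ∈ Set.Icc (0 : ℝ) 1, (S ε t).re ∈ Set.Icc ε (1 - ε) ∧ (S ε t).im ∈ Set.Icc 0 (1 - ε) ∧ (t ∈ Set.Ioo (0 : ℝ) 1 → 0 < (S ε t).im)) ∧ (∀ ε ∈ Set.Icc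 (0 : ℝ) (1 / 2), ∀ t ∈ Set.Icc (0 : ℝ) 1, dist (S ε t) (S 0 t) ≤ 2 * ε) ∧ (∀ t ∈ Set.Icc (0 : ℝ) (1 / 3), segment ℝ 0 (S 0 t) ⊆ S 0 '' Set.Icc 0 t ∧ S 0 t ∈ segment ℝ (0 : ℂ) Complex.I) ∧ S 0 (1 / 3) = Complex.I ∧ (∀ t ∈ Set.Icc (1 / 3 : ℝ) (2 / 3), segment ℝ Complex.I (S 0 t) ⊆ S 0 '' Set.Icc (1 / 3) t ∧ S 0 t ∈ segment ℝ Complex.I (1 + Complex.I)) ∧ S 0 (2 / 3) = 1 + Complex.I ∧ (∀ t ∈ Set.Icc (2 / 3 : ℝ) 1, segment ℝ (1 + Complex.I) (S 0 t) ⊆ S 0 '' Set.Icc (2 / 3) t ∧ S 0 t ∈ segment ℝ (1 + Complex.I) 1) ∧ S 0 1 = 1 := by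
  set S : ℝ → ℝ → ℂ := fun ε t => if t ≤ 1 / 3 then (ε : ℂ) + ((3 * t * (1 - ε) : ℝ) : ℂ) *
    Complex.I else if t ≤ 2 / 3 then ((ε + (3 * t - 1) * (1 - 2 * ε) : ℝ) : ℂ) +
    ((1 - ε : ℝ) : ℂ) * Complex.I else ((1 - ε : ℝ) : ℂ) + (((3 - 3 * t) * (1 - ε) : ℝ) : ℂ) *
    Complex.I with hSdef
  have hS : ∀ ε t, S ε t = if t ≤ 1 / 3 then (ε : ℂ) + ((3 * t * (1 - ε) : ℝ) : ℂ) * Complex.I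
      else if t ≤ 2 / 3 then ((ε + (3 * t - 1) * (1 - 2 * ε) : ℝ) : ℂ) + ((1 - ε : ℝ) : ℂ) *
      Complex.I else ((1 - ε : ℝ) : ℂ) + (((3 - 3 * t) * (1 - ε) : ℝ) : ℂ) * Complex.I :=
    fun ε t => rfl
  obtain ⟨A1, A2, A3, A4, A5, A6⟩ := squareInset_zero_segments hS
  refine ⟨S, continuous_squareInset hS, fun ε hε => injOn_squareInset hS hε,
    fun ε t ht => squareInset_piece₁ hS ε ht, fun ε hε t ht => half_le_dist_squareInset hS hε ht,
    fun ε => ?_, fun ε hε t ht => squareInset_coord hS hε ht,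
    fun ε hε t ht => dist_squareInset_le hS hε ht, A1, A2, A3, A4, A5, A6⟩
  rw [squareInset_piece₃ hS ε (by norm_num)]; push_cast; ring

end Summit.CriticalPhenomena.CardyFormulaZ2.Theorems.CardySelfRefinement

end
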